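import Summits.ValiantsHypothesis.ValiantsHypothesis.Theorems.GrenetZeonDualUnipotentThreeHalvesLongMassResolventExact
import Summits.ValiantsHypothesis.ValiantsHypothesis.Theorems.GrenetZeonDualUnipotentThreeHalvesLongMassCeilings

/-!
# `GrenetZeon.DualUnipotentThreeHalves` (stmt-ValiantsHypothesis-24318), line `slow_core`, stub (c) `SlowCore.LongMassSlowLawInv`:
# the INDEX SHADOW of a certificate — ledger directions are nilpotent of index ≤ k+1; order-0 certificates are freezes; an index-census price floor

The registered research stub (c) asks, for every (irreducible — irreducibility is free, ✓ `…LongMassIrreducibilityFree.inv_iff_all`) nilpotent affine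
`b × b` pencil `B` over the `n²` coordinates, for a whole-pencil certificate `SlowCore.RelCert n b B (c·√n·b)`: a direction space `K` and an order `k`
with `SlowCore.Ledger n b B ⊤ K k` (along every line `x + s·v`, `v ∈ K`, every power `p ≤ n − 1` of `B(x + s v)` has `s`-degree `≤ k`) and
`n·k + codim K ≤ c·√n·b`.  The census so far prices certificates from ABOVE (universal ceilings U1/U2/U3 ✓ `…LongMassCeilings`, rows r3/r4/r8/r12, …)
and from below only for torus-equivariant pencils (✓ `LedgerTorus.not_relCert_of_count`).  This file adds the simplest LOWER-side instrument, valid for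
EVERY affine nilpotent pencil, read off the exact dictionary ✓ `ResolventFlag.ledger_top_iff_twist_pow_congr` at `u = 0`:

* §1 `coeff_zero_twist_pow_apply` — the constant `u`-coefficient of the `p`-th power of the twist `R_{N(x)}(u)·lin v` is the `p`-th power of the bare
  linear part: `[u⁰] ((twist N x v)^p)_{ij} = ((linMat N v)^p)_{ij}` (`R_A(0) = 1`).
* §2 ★ `linMat_pow_eq_zero_of_ledger` — **INDEX SHADOW.**  If `(K, k)` is a whole-pencil ledger of an affine pencil `N` with `N^m = 0` and the window
  sees the power `k + 1` (`k + 2 ≤ n`), then EVERY direction `v ∈ K` has `(linMat N v)^(k+1) = 0`: the image `lin K` is a linear space of nilpotent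
  matrices of nil-index `≤ k + 1`.  (Paper: the `s^{k+1}`-coefficient of `(A + sB)^{k+1}` is `B^{k+1}`.)  Contrapositive `not_ledger_of_linMat_pow_ne_zero`.
* §3 ★ `linMat_eq_zero_of_ledger_zero`, `ledger_zero_iff_forall_linMat_eq_zero` — **ORDER-0 CERTIFICATES ARE FREEZES** (`n ≥ 2`): `(K, 0)` is a ledger iff
  `K` freezes every position; hence ★ `mass_le_of_ledger_zero` — an order-0 certificate costs at least the MASS `μ = rank lin` (✓ `Ceilings.mass`), i.e. the
  ceiling U1 ✓ `relCert_freeze` is also the FLOOR among order-0 certificates (`relCert_zero_iff_mass_le`).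
* §4 ★ `exists_indexShadow_of_relCert`, `le_price_of_indexCensus` — the pluggable forms: a certificate of price `P` leaves an index shadow
  (`∃ K k, n·k + codim K ≤ P ∧ (k + 2 ≤ n → ∀ v ∈ K, (lin v)^{k+1} = 0)`); so if for every order `k` with `k + 2 ≤ n` every direction space of
  index-`≤ k+1` linear parts has `finrank ≤ D k` (an INDEX CENSUS of the pencil), every certificate price `P` satisfies `n·k + (n² − D k) ≤ P` for some
  such `k`, or `n·k ≤ P` for some `k` beyond the window.
* §5 `indexShadowLaw_of_longMassSlowLawInv` — the by-name shadow of the stub: (c) ⟹ every `IrreducibleInv` nilpotent affine pencil admits `K, k` with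
  `n·k + codim K ≤ c·√n·b` whose directions have linear parts of nil-index `≤ k + 1` (when `k + 2 ≤ n`).  A (c)-violator may therefore be certified by an
  index census alone: a nilpotent pencil family none of whose cheap direction spaces is of bounded nil-index.

HONEST FRAMING.  An INSTRUMENT / necessary condition in the stub's own currency (`--supports stmt-ValiantsHypothesis-24318`); NOT progress on (c)
`LongMassSlowLawInv` (RESEARCH — OPEN); closes no stub; S3 `SlowPlane`, 24318, 8062 (`stub_dualUnipotent`) and `VP ≠ VNP` are NOT proved.  Remark (paper, not
typed): the index shadow alone can never refute (c) by a pure dimension count — a linear space of dimension `> b²/k` in `M_b(ℂ)` always meets the cone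
`{X : X^k = 0}` (projective dimension), which is exactly the `√n·b` scale of (c); refutations must use the full congruence of ✓ `ledger_top_iff_twist_pow_congr`.
No `sorry`, no definitions, no named facts.  [folklore: top coefficient of a matrix pencil power]
-/

set_option linter.dupNamespace false
set_option autoImplicit false

namespace Summit.ValiantsHypothesis.ValiantsHypothesis.Theorems.GrenetZeon.LedgerIndex

open MvPolynomial Matrix
open scoped BigOperators Polynomial
open Summit.ValiantsHypothesis.ValiantsHypothesis.Cruxes.TwoDimCoefficients.DimTwoCases (AffMat IsAffine)
open Summit.ValiantsHypothesis.ValiantsHypothesis.Theorems.GrenetZeon.SlowCore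
  (linEntry Ledger RelCert IrreducibleInv LongMassSlowLawInv freezeSpace linEntry_eq_zero_of_mem_freezeSpace linFun_apply)
open Summit.ValiantsHypothesis.ValiantsHypothesis.Theorems.GrenetZeon.ResolventFlag
  (pointMat linMat resolvent twist ledger_top_iff_twist_pow_congr)
open Summit.ValiantsHypothesis.ValiantsHypothesis.Theorems.GrenetZeon.Ceilings (mass relCert_freeze map_lineSubst_of_mem_freezeSpace_univ)
open Summit.ValiantsHypothesis.ValiantsHypothesis.Theorems.GrenetZeon.RadicalSplit (lineSubst)

variable {n m : ℕ}

/-! ## §1 The twist at `u = 0` is the bare linear part -/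

/-- `R_A(0) = 1`: the constant `u`-coefficient matrix of the resolvent is the identity. [folklore] -/
theorem resolvent_map_eval_zero (N : AffMat n m) (x : Fin n × Fin n → ℂ) :
    (resolvent N x).map (Polynomial.eval 0) = 1 := by
  rcases Nat.eq_zero_or_pos m with hm | hm
  · subst hm; ext i j; exact Fin.elim0 i
  · ext i j
    rw [Matrix.map_apply, show resolvent N x = ∑ a ∈ Finset.range m,
        (Polynomial.X : ℂ[X]) ^ a • ((pointMat N x) ^ a).map Polynomial.C from rfl, Matrix.sum_apply,
      Polynomial.eval_finsetSum]
    simp_rw [Matrix.smul_apply, Matrix.map_apply, smul_eq_mul, Polynomial.eval_mul, Polynomial.eval_pow,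
      Polynomial.eval_X, Polynomial.eval_C]
    rw [Finset.sum_eq_single 0]
    · simp
    · intro a _ ha
      rw [zero_pow ha, zero_mul]
    · intro h; exact absurd (Finset.mem_range.2 hm) h

/-- ★ **The twist at `u = 0`.**  `[u⁰] ((R_{N(x)}(u)·lin v)^p)_{ij} = ((lin v)^p)_{ij}`. [folklore] -/
theorem coeff_zero_twist_pow_apply (N : AffMat n m) (x v : Fin n × Fin n → ℂ) (p : ℕ) (i j : Fin m) :
    Polynomial.coeff (((twist N x v) ^ p) i j) 0 = ((linMat N v) ^ p) i j := by
  have hmap : ((twist N x v) ^ p).map (Polynomial.evalRingHom (0 : ℂ)) = (linMat N v) ^ p := by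
    rw [Matrix.map_pow, show twist N x v = resolvent N x * (linMat N v).map Polynomial.C from rfl, Matrix.map_mul,
      Polynomial.coe_evalRingHom, resolvent_map_eval_zero, Matrix.one_mul, Matrix.map_map]
    have hlin : (linMat N v).map (Polynomial.eval (0 : ℂ) ∘ (Polynomial.C : ℂ → ℂ[X])) = linMat N v := by
      ext a b
      rw [Matrix.map_apply, Function.comp_apply, Polynomial.eval_C]
    rw [hlin]
  have h := congr_fun (congr_fun hmap i) j
  rw [Matrix.map_apply, Polynomial.coe_evalRingHom] at h
  rw [Polynomial.coeff_zero_eq_eval_zero, h]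

/-! ## §2 The index shadow of a ledger -/

/-- ★ **INDEX SHADOW.**  The directions of a whole-pencil ledger `(K, k)` have linear parts of nil-index `≤ k + 1`, as soon as the window sees the
`(k+1)`-st power (`k + 2 ≤ n`).  [folklore: `[s^{k+1}](A + sB)^{k+1} = B^{k+1}`; here via ✓ `ledger_top_iff_twist_pow_congr` at `u = 0`] -/
theorem linMat_pow_eq_zero_of_ledger (N : AffMat n m) (hN : IsAffine N) (hnil : N ^ m = 0)
    {K : Submodule ℂ (Fin n × Fin n → ℂ)} {k : ℕ} (hL : Ledger n m N (fun _ => True) K k) (hk : k + 2 ≤ n)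
    {v : Fin n × Fin n → ℂ} (hv : v ∈ K) : (linMat N v) ^ (k + 1) = 0 := by
  have h := (ledger_top_iff_twist_pow_congr N hN hnil K k).1 hL 0 v hv
  ext i j
  rw [← coeff_zero_twist_pow_apply N 0 v (k + 1) i j, Matrix.zero_apply]
  exact h i j 0 (by omega)

/-- Contrapositive census form: ONE direction `v ∈ K` with `(lin v)^{k+1} ≠ 0` kills the ledger `(K, k)` (window `k + 2 ≤ n`). -/
theorem not_ledger_of_linMat_pow_ne_zero (N : AffMat n m) (hN : IsAffine N) (hnil : N ^ m = 0)
    {K : Submodule ℂ (Fin n × Fin n → ℂ)} {k : ℕ} (hk : k + 2 ≤ n) {v : Fin n × Fin n → ℂ} (hv : v ∈ K)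
    (hne : (linMat N v) ^ (k + 1) ≠ 0) : ¬ Ledger n m N (fun _ => True) K k :=
  fun hL => hne (linMat_pow_eq_zero_of_ledger N hN hnil hL hk hv)

/-! ## §3 Order-0 certificates are freezes; the mass is the floor at order 0 -/

/-- ★ **Order 0 ⇒ frozen.**  A ledger of order `0` (window `2 ≤ n`) moves no entry: `lin v = 0` for every `v ∈ K`. -/
theorem linMat_eq_zero_of_ledger_zero (N : AffMat n m) (hN : IsAffine N) (hnil : N ^ m = 0)
    {K : Submodule ℂ (Fin n × Fin n → ℂ)} (hL : Ledger n m N (fun _ => True) K 0) (hn : 2 ≤ n)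
    {v : Fin n × Fin n → ℂ} (hv : v ∈ K) : linMat N v = 0 := by
  have h := linMat_pow_eq_zero_of_ledger N hN hnil hL (k := 0) (by omega) hv
  rwa [zero_add, pow_one] at h

/-- An order-0 ledger's direction space lies in the freezing space of ALL positions. -/
theorem le_freezeSpace_of_ledger_zero (N : AffMat n m) (hN : IsAffine N) (hnil : N ^ m = 0)
    {K : Submodule ℂ (Fin n × Fin n → ℂ)} (hL : Ledger n m N (fun _ => True) K 0) (hn : 2 ≤ n) :
    K ≤ freezeSpace N (Finset.univ : Finset (Fin m × Fin m)) := by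
  intro v hv
  rw [freezeSpace, LinearMap.mem_ker]
  ext r
  have h := congr_fun (congr_fun (linMat_eq_zero_of_ledger_zero N hN hnil hL hn hv) r.1.1) r.1.2
  rw [linMat, Matrix.of_apply, Matrix.zero_apply] at h
  rw [LinearMap.pi_apply, linFun_apply, h]
  rfl

/-- Conversely, the freezing space of all positions is an order-0 ledger (the body of ✓ U1 `relCert_freeze`). -/
theorem ledger_zero_of_le_freezeSpace (N : AffMat n m) (hN : IsAffine N)
    {K : Submodule ℂ (Fin n × Fin n → ℂ)} (hK : K ≤ freezeSpace N (Finset.univ : Finset (Fin m × Fin m))) :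
    Ledger n m N (fun _ => True) K 0 := by
  intro x v hv b _ i j _ _
  rw [map_lineSubst_of_mem_freezeSpace_univ N hN x v (hK hv)]
  exact (Summit.ValiantsHypothesis.ValiantsHypothesis.Theorems.GrenetZeon.SlowCore.totalDegree_map_C_pow_apply _ b i j).le

/-- ★ **ORDER-0 CERTIFICATES ARE FREEZES** (`2 ≤ n`, `N^m = 0`): `(K, 0)` is a whole-pencil ledger iff `K` freezes every position. -/
theorem ledger_zero_iff_le_freezeSpace (N : AffMat n m) (hN : IsAffine N) (hnil : N ^ m = 0) (hn : 2 ≤ n)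
    (K : Submodule ℂ (Fin n × Fin n → ℂ)) :
    Ledger n m N (fun _ => True) K 0 ↔ K ≤ freezeSpace N (Finset.univ : Finset (Fin m × Fin m)) :=
  ⟨fun hL => le_freezeSpace_of_ledger_zero N hN hnil hL hn, ledger_zero_of_le_freezeSpace N hN⟩

/-- ★ **The MASS is the floor at order 0.**  Every order-0 ledger `(K, 0)` has `codim K ≥ mass N` (`2 ≤ n`): together with ✓ U1 `relCert_freeze`
(price `= mass N`) the freeze is OPTIMAL among order-0 certificates. -/
theorem mass_le_of_ledger_zero (N : AffMat n m) (hN : IsAffine N) (hnil : N ^ m = 0)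
    {K : Submodule ℂ (Fin n × Fin n → ℂ)} (hL : Ledger n m N (fun _ => True) K 0) (hn : 2 ≤ n) :
    mass N ≤ n * n - Module.finrank ℂ K := by
  have h := Submodule.finrank_mono (le_freezeSpace_of_ledger_zero N hN hnil hL hn)
  rw [mass]
  omega

/-- Order-0 certificates of price `P` exist iff `mass N ≤ P` (`2 ≤ n`). -/
theorem relCert_zero_iff_mass_le (N : AffMat n m) (hN : IsAffine N) (hnil : N ^ m = 0) (hn : 2 ≤ n) (P : ℕ) :
    (∃ K : Submodule ℂ (Fin n × Fin n → ℂ), Ledger n m N (fun _ => True) K 0 ∧ n * n - Module.finrank ℂ K ≤ P) ↔ mass N ≤ P := by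
  constructor
  · rintro ⟨K, hL, hP⟩
    exact (mass_le_of_ledger_zero N hN hnil hL hn).trans hP
  · intro hP
    refine ⟨freezeSpace N Finset.univ, ledger_zero_of_le_freezeSpace N hN le_rfl, ?_⟩
    rw [mass] at hP
    exact hP

/-! ## §4 Pluggable forms: the shadow of a certificate, and the index-census price floor -/

/-- ★ **The index shadow of a certificate of price `P`.** -/
theorem exists_indexShadow_of_relCert (N : AffMat n m) (hN : IsAffine N) (hnil : N ^ m = 0) {P : ℕ} (h : RelCert n m N P) :
    ∃ (K : Submodule ℂ (Fin n × Fin n → ℂ)) (k : ℕ), n * k + (n * n - Module.finrank ℂ K) ≤ P ∧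
      (k + 2 ≤ n → ∀ v ∈ K, (linMat N v) ^ (k + 1) = 0) := by
  obtain ⟨K, k, hL, hc⟩ := h
  exact ⟨K, k, hc, fun hk v hv => linMat_pow_eq_zero_of_ledger N hN hnil hL hk hv⟩

/-- ★ **INDEX-CENSUS PRICE FLOOR.**  If for every order `k` inside the window (`k + 2 ≤ n`) every direction space whose linear parts are
nilpotent of index `≤ k + 1` has `finrank ≤ D k`, then every certificate price `P` satisfies: `n·k + (n² − D k) ≤ P` for some `k` inside the
window, or `n·k ≤ P` for some `k` beyond it (`n < k + 2`). -/
theorem le_price_of_indexCensus (N : AffMat n m) (hN : IsAffine N) (hnil : N ^ m = 0) (D : ℕ → ℕ)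
    (hD : ∀ k : ℕ, k + 2 ≤ n → ∀ K : Submodule ℂ (Fin n × Fin n → ℂ),
      (∀ v ∈ K, (linMat N v) ^ (k + 1) = 0) → Module.finrank ℂ K ≤ D k)
    {P : ℕ} (h : RelCert n m N P) :
    ∃ k : ℕ, (k + 2 ≤ n ∧ n * k + (n * n - D k) ≤ P) ∨ (n < k + 2 ∧ n * k ≤ P) := by
  obtain ⟨K, k, hc, hsh⟩ := exists_indexShadow_of_relCert N hN hnil h
  refine ⟨k, ?_⟩
  by_cases hk : k + 2 ≤ n
  · left
    have hDK := hD k hk K (hsh hk)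
    refine ⟨hk, ?_⟩
    have : n * n - D k ≤ n * n - Module.finrank ℂ K := Nat.sub_le_sub_left hDK _
    omega
  · right
    exact ⟨by omega, by omega⟩

/-! ## §5 The by-name shadow of the stub (c) -/

/-- The **INDEX SHADOW LAW** implied by (c) `SlowCore.LongMassSlowLawInv`: every `IrreducibleInv` nilpotent affine `b × b` pencil (large `n`) admits a
direction space `K` and an order `k` of price `n·k + codim K ≤ c·√n·b` whose directions have linear parts of nil-index `≤ k + 1` whenever the window
sees that power.  A family violating THIS (an index census, no degrees of matrix powers along lines) refutes (c). -/
theorem indexShadowLaw_of_longMassSlowLawInv (h : LongMassSlowLawInv) :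
    ∃ c n₀ : ℕ, ∀ n ≥ n₀, ∀ b : ℕ, ∀ B : AffMat n b, IsAffine B → B ^ b = 0 → IrreducibleInv B →
      ∃ (K : Submodule ℂ (Fin n × Fin n → ℂ)) (k : ℕ), n * k + (n * n - Module.finrank ℂ K) ≤ c * (Nat.sqrt n * b) ∧
        (k + 2 ≤ n → ∀ v ∈ K, (linMat B v) ^ (k + 1) = 0) := by
  obtain ⟨c, n₀, hc⟩ := h
  exact ⟨c, n₀, fun n hn b B hB hnil hirr => exists_indexShadow_of_relCert B hB hnil (hc n hn b B hB hnil hirr)⟩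

end Summit.ValiantsHypothesis.ValiantsHypothesis.Theorems.GrenetZeon.LedgerIndex
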